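import Literature.Geometry.DiscreteGeometry.KissingEdgeDeficit
import Literature.Geometry.DiscreteGeometry.KissingFanCensus
import HarnessLib

/-!
# The fan triangles of the hull of a spherical code form a closed surface:
# every side of a fan triangle lies in exactly two fan triangles

Topic `Literature/Geometry/DiscreteGeometry`.  For a finite set `X` of unit vectors of `ℝ³` with
`0 ∈ interior (conv X)`, each facet of `conv X` (tight set of a facet normal `c`, vertices
`w = fVert X c` in counter-clockwise order, `m_c` of them) is cut into the `m_c − 2` fan triangles
`(w 0, w (i+1), w (i+2))` (`KissingFanCensus.lean`, `SphericalPolygonFan.lean`).  This file proves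
the COMBINATORIAL closed-surface property of the resulting triangulation, the interface of any
finite enumeration of such triangulations:

* Part A. `pair_mem_hullEdges_of_two_facets`: **two distinct facets sharing two points share a
  hull edge** (the average of the two facet normals is an edge normal: its tight set is the
  intersection of the two tight sets, which cannot contain a third point by
  `eq_of_three_mem_tightSet`).
* Part B. `fanTriangles X` (the pairs `(c, i)`, `c` a facet normal, `i + 2 < m_c`), `fanVerts`
  (the three vertices), `fanVerts_card` (`= 3`), `fanVerts_subset_tightSet`;
  `card_fanTriangles_eq_sum` (`#fanTriangles = Σ_c (m_c − 2)`).
* Part C. The count inside one facet: `countInFacet X c s = #{i < m_c − 2 | s ⊆ fanVerts (c,i)}`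
  for a pair `s = {w a, w b}`, `a < b < m_c`: `2` for a diagonal (`a = 0`, `2 ≤ b ≤ m_c − 2`),
  `1` for a polygon side (`b = a + 1`, or `{a, b} = {0, m_c − 1}`), `0` otherwise
  (`countInFacet_diagonal`, `countInFacet_side`, `countInFacet_first`, `countInFacet_last`).
* Part D. **`card_fanTriangles_filter_eq_two`**: for `p ∈ fanTriangles X` and a two-element
  `s ⊆ fanVerts X p`, exactly two fan triangles contain `s` — a diagonal lies in two fan
  triangles of its own facet and in no other facet (Part A + `consecutive_of_mem_hullEdges`),
  a polygon side is a hull edge, lies in exactly two facets (`card_facetsOfEdge`) and in exactly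
  one fan triangle of each.

Everything is PROVED; no named facts.

## References
* A.-M. Legendre, *Éléments de géométrie* (1794), VII (Euler's formula via the spherical
  subdivision). [folklore]
-/

noncomputable section

namespace Literature.Geometry.DiscreteGeometry

open Real RealInnerProductSpace Finset

local notation "E3" => EuclideanSpace ℝ (Fin 3)

variable {X : Finset E3}

/-! ### Part A. Two facets sharing two points share a hull edge -/

section TwoFacets

/-- **Two distinct facets sharing two points `u ≠ v` share the hull edge `{u, v}`.**
[folklore] -/
theorem pair_mem_hullEdges_of_two_facets (hX1 : ∀ y ∈ X, ‖y‖ = 1) {c c' : E3}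
    (hc : c ∈ facetNormals X) (hc' : c' ∈ facetNormals X) (hcc : c ≠ c') {u v : E3}
    (hu : u ∈ tightSet X c) (hv : v ∈ tightSet X c) (hu' : u ∈ tightSet X c')
    (hv' : v ∈ tightSet X c') (huv : u ≠ v) : ({u, v} : Finset E3) ∈ hullEdges X := by
  classical
  have hcF := (mem_facetNormals.1 hc).1
  have hcF' := (mem_facetNormals.1 hc').1
  set c₀ : E3 := (1 / 2 : ℝ) • (c + c') with hc₀
  have hval : ∀ y ∈ X, ⟪c₀, y⟫ = (⟪c, y⟫ + ⟪c', y⟫) / 2 := fun y _ => by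
    rw [hc₀, real_inner_smul_left, inner_add_left]; ring
  -- the tight set of `c₀` is the intersection of the two tight sets …
  have htight : ∀ y, y ∈ tightSet X c₀ ↔ y ∈ tightSet X c ∧ y ∈ tightSet X c' := by
    intro y
    rw [mem_tightSet, mem_tightSet, mem_tightSet]
    constructor
    · rintro ⟨hyX, h1⟩
      rw [hval y hyX] at h1
      have h₁ := hcF y hyX
      have h₂ := hcF' y hyX
      exact ⟨⟨hyX, by linarith⟩, ⟨hyX, by linarith⟩⟩
    · rintro ⟨⟨hyX, h1⟩, ⟨-, h2⟩⟩
      refine ⟨hyX, ?_⟩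
      rw [hval y hyX, h1, h2]; norm_num
  -- … which is `{u, v}` (a third common point would force `c = c'`)
  have hset : tightSet X c₀ = {u, v} := by
    ext y
    rw [htight, Finset.mem_insert, Finset.mem_singleton]
    constructor
    · rintro ⟨hy, hy'⟩
      by_contra hne
      push Not at hne
      exact hcc (eq_of_three_mem_tightSet hX1 hc hu hv hy hu' hv' hy' huv (Ne.symm hne.1)
        (Ne.symm hne.2))
    · rintro (rfl | rfl)
      · exact ⟨hu, hu'⟩
      · exact ⟨hv, hv'⟩
  refine mem_hullEdges.2 ⟨c₀, ⟨fun y hy => ?_, ?_⟩, hset⟩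
  · rw [hval y hy]
    linarith [hcF y hy, hcF' y hy]
  · rw [hset, Finset.card_pair huv]

end TwoFacets

/-! ### Part B. The fan triangles and their vertices -/

section FanTriangles

/-- **The fan triangles of the hull of `X`**: the pairs `(c, i)` with `c` a facet normal and
`i + 2 < m_c` (the triangle `(w 0, w (i+1), w (i+2))`, `w = fVert X c`). [folklore] -/
def fanTriangles (X : Finset E3) : Finset (E3 × ℕ) :=
  (facetNormals X ×ˢ range X.card).filter fun p => p.2 + 2 < (tightSet X p.1).card

/-- Membership in `fanTriangles`. [folklore] -/
theorem mem_fanTriangles {p : E3 × ℕ} :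
    p ∈ fanTriangles X ↔ p.1 ∈ facetNormals X ∧ p.2 + 2 < (tightSet X p.1).card := by
  unfold fanTriangles
  rw [Finset.mem_filter, Finset.mem_product, Finset.mem_range]
  constructor
  · rintro ⟨⟨h1, -⟩, h2⟩; exact ⟨h1, h2⟩
  · rintro ⟨h1, h2⟩
    refine ⟨⟨h1, ?_⟩, h2⟩
    have : (tightSet X p.1).card ≤ X.card := Finset.card_le_card (tightSet_subset X p.1)
    omega

/-- **The three vertices of a fan triangle.** [folklore] -/
def fanVerts (X : Finset E3) (p : E3 × ℕ) : Finset E3 :=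
  {fVert X p.1 0, fVert X p.1 (p.2 + 1), fVert X p.1 (p.2 + 2)}

/-- A vertex of a facet (by index) is tight. [folklore] -/
theorem fVert_mem_tightSet_of_lt (hX1 : ∀ y ∈ X, ‖y‖ = 1) {c : E3} (hc : c ∈ facetNormals X)
    {j : ℕ} (hj : j < (tightSet X c).card) : fVert X c j ∈ tightSet X c := by
  have hc0 := ne_zero_of_mem_facetNormals hX1 hc
  rw [fVert_eq hc0]
  exact facetVertex_mem hc0 (by rwa [card_facetAngles hX1 hc0])

/-- The vertices of a fan triangle are tight for its facet. [folklore] -/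
theorem fanVerts_subset_tightSet (hX1 : ∀ y ∈ X, ‖y‖ = 1) {p : E3 × ℕ} (hp : p ∈ fanTriangles X) :
    fanVerts X p ⊆ tightSet X p.1 := by
  obtain ⟨hc, hi⟩ := mem_fanTriangles.1 hp
  intro y hy
  unfold fanVerts at hy
  rw [Finset.mem_insert, Finset.mem_insert, Finset.mem_singleton] at hy
  rcases hy with rfl | rfl | rfl
  · exact fVert_mem_tightSet_of_lt hX1 hc (by omega)
  · exact fVert_mem_tightSet_of_lt hX1 hc (by omega)
  · exact fVert_mem_tightSet_of_lt hX1 hc hi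

/-- Distinct indices below `m_c` give distinct vertices (restated in `fVert` form from
`facetVertex_injOn`). [folklore] -/
theorem fVert_injective_of_lt (hX1 : ∀ y ∈ X, ‖y‖ = 1) {c : E3} (hc : c ∈ facetNormals X)
    {j k : ℕ} (hj : j < (tightSet X c).card) (hk : k < (tightSet X c).card)
    (h : fVert X c j = fVert X c k) : j = k := by
  have hc0 := ne_zero_of_mem_facetNormals hX1 hc
  rw [fVert_eq hc0, fVert_eq hc0] at h
  rw [← card_facetAngles hX1 hc0] at hj hk
  exact facetVertex_injOn (X := X) hc0 (Finset.mem_coe.2 (Finset.mem_range.2 hj))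
    (Finset.mem_coe.2 (Finset.mem_range.2 hk)) h

/-- **A fan triangle has three distinct vertices.** [folklore] -/
theorem fanVerts_card (hX1 : ∀ y ∈ X, ‖y‖ = 1) {p : E3 × ℕ} (hp : p ∈ fanTriangles X) :
    (fanVerts X p).card = 3 := by
  obtain ⟨hc, hi⟩ := mem_fanTriangles.1 hp
  have h01 : fVert X p.1 0 ≠ fVert X p.1 (p.2 + 1) := fun h => by
    have := fVert_injective_of_lt hX1 hc (by omega) (by omega) h; omega
  have h02 : fVert X p.1 0 ≠ fVert X p.1 (p.2 + 2) := fun h => by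
    have := fVert_injective_of_lt hX1 hc (by omega) hi h; omega
  have h12 : fVert X p.1 (p.2 + 1) ≠ fVert X p.1 (p.2 + 2) := fun h => by
    have := fVert_injective_of_lt hX1 hc (by omega) hi h; omega
  unfold fanVerts
  rw [Finset.card_insert_of_notMem, Finset.card_pair h12]
  rw [Finset.mem_insert, Finset.mem_singleton, not_or]
  exact ⟨h01, h02⟩

/-- **The number of fan triangles is `Σ_c (m_c − 2)`** (`= 20` for twelve points,
`card_fanTriangles`). [folklore] -/
theorem card_fanTriangles_eq_sum (X : Finset E3) :
    (fanTriangles X).card = ∑ c ∈ facetNormals X, ((tightSet X c).card - 2) := by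
  classical
  unfold fanTriangles
  rw [Finset.card_filter, Finset.sum_product]
  refine Finset.sum_congr rfl fun c hc => ?_
  have hle : (tightSet X c).card ≤ X.card := Finset.card_le_card (tightSet_subset X c)
  rw [Finset.sum_boole, Nat.cast_id]
  have : (range X.card).filter (fun i => i + 2 < (tightSet X c).card) = range ((tightSet X c).card - 2) := by
    ext i
    simp only [Finset.mem_filter, Finset.mem_range]
    omega
  rw [this, Finset.card_range]

end FanTriangles

/-! ### Part C. How many fan triangles of ONE facet contain a given pair of its vertices -/

section InFacet

/-- **The number of fan triangles of the facet of `c` containing the pair `s`.** [folklore] -/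
def countInFacet (X : Finset E3) (c : E3) (s : Finset E3) : ℕ :=
  ((range ((tightSet X c).card - 2)).filter fun i => s ⊆ fanVerts X (c, i)).card

/-- If `s` is not inside the facet, no fan triangle of the facet contains it. [folklore] -/
theorem countInFacet_eq_zero_of_not_subset (hX1 : ∀ y ∈ X, ‖y‖ = 1) {c : E3}
    (hc : c ∈ facetNormals X) {s : Finset E3} (hs : ¬s ⊆ tightSet X c) : countInFacet X c s = 0 := by
  unfold countInFacet
  rw [Finset.card_eq_zero, Finset.filter_eq_empty_iff]
  intro i hi hsub
  have hi' := Finset.mem_range.1 hi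
  exact hs (hsub.trans (fanVerts_subset_tightSet hX1 (p := (c, i)) (mem_fanTriangles.2 ⟨hc, by
    simp only; omega⟩)))

/-- **Membership test by indices**: for `a < b < m_c` and `i + 2 < m_c`, the pair
`{w a, w b}` lies in the fan triangle `(w 0, w (i+1), w (i+2))` iff
`(a = 0 ∧ (b = i+1 ∨ b = i+2)) ∨ (a = i+1 ∧ b = i+2)`. [folklore] -/
theorem pair_subset_fanVerts_iff (hX1 : ∀ y ∈ X, ‖y‖ = 1) {c : E3} (hc : c ∈ facetNormals X)
    {a b i : ℕ} (hab : a < b) (hb : b < (tightSet X c).card) (hi : i + 2 < (tightSet X c).card) :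
    ({fVert X c a, fVert X c b} : Finset E3) ⊆ fanVerts X (c, i) ↔
      (a = 0 ∧ (b = i + 1 ∨ b = i + 2)) ∨ (a = i + 1 ∧ b = i + 2) := by
  have hI : ∀ {j k : ℕ}, j < (tightSet X c).card → k < (tightSet X c).card →
      fVert X c j = fVert X c k → j = k := fun hj hk h => fVert_injective_of_lt hX1 hc hj hk h
  unfold fanVerts
  simp only [Finset.insert_subset_iff, Finset.singleton_subset_iff, Finset.mem_insert,
    Finset.mem_singleton]
  constructor
  · rintro ⟨ha', hb'⟩
    rcases ha' with h | h | h
    · have ha0 := hI (by omega) (by omega) h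
      rcases hb' with h' | h' | h'
      · have := hI hb (by omega) h'; omega
      · exact Or.inl ⟨ha0, Or.inl (hI hb (by omega) h')⟩
      · exact Or.inl ⟨ha0, Or.inr (hI hb hi h')⟩
    · have ha1 := hI (by omega) (by omega) h
      rcases hb' with h' | h' | h'
      · have := hI hb (by omega) h'; omega
      · have := hI hb (by omega) h'; omega
      · exact Or.inr ⟨ha1, hI hb hi h'⟩
    · have ha2 := hI (by omega) hi h
      rcases hb' with h' | h' | h'
      · have := hI hb (by omega) h'; omega
      · have := hI hb (by omega) h'; omega
      · have := hI hb hi h'; omega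
  · rintro (⟨rfl, rfl | rfl⟩ | ⟨rfl, rfl⟩)
    · exact ⟨Or.inl rfl, Or.inr (Or.inl rfl)⟩
    · exact ⟨Or.inl rfl, Or.inr (Or.inr rfl)⟩
    · exact ⟨Or.inr (Or.inl rfl), Or.inr (Or.inr rfl)⟩

/-- **A diagonal `{w 0, w b}` (`2 ≤ b ≤ m_c − 2`) lies in exactly two fan triangles of its facet**
(`i = b − 2` and `i = b − 1`). [folklore] -/
theorem countInFacet_diagonal (hX1 : ∀ y ∈ X, ‖y‖ = 1) {c : E3} (hc : c ∈ facetNormals X)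
    {b : ℕ} (h2 : 2 ≤ b) (hb : b + 2 ≤ (tightSet X c).card) :
    countInFacet X c {fVert X c 0, fVert X c b} = 2 := by
  unfold countInFacet
  have hfilter : (range ((tightSet X c).card - 2)).filter
      (fun i => ({fVert X c 0, fVert X c b} : Finset E3) ⊆ fanVerts X (c, i)) = {b - 2, b - 1} := by
    ext i
    rw [Finset.mem_filter, Finset.mem_range, Finset.mem_insert, Finset.mem_singleton]
    constructor
    · rintro ⟨hi, hsub⟩
      rw [pair_subset_fanVerts_iff hX1 hc (by omega) (by omega) (by omega)] at hsub
      omega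
    · intro hi
      have hi' : i < (tightSet X c).card - 2 := by omega
      refine ⟨hi', ?_⟩
      rw [pair_subset_fanVerts_iff hX1 hc (by omega) (by omega) (by omega)]
      omega
  rw [hfilter, Finset.card_pair (by omega)]

/-- **The first polygon side `{w 0, w 1}` lies in exactly one fan triangle of its facet**
(`i = 0`). [folklore] -/
theorem countInFacet_first (hX1 : ∀ y ∈ X, ‖y‖ = 1) {c : E3} (hc : c ∈ facetNormals X) :
    countInFacet X c {fVert X c 0, fVert X c 1} = 1 := by
  have hm : 3 ≤ (tightSet X c).card := three_le_card_tightSet hc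
  unfold countInFacet
  have hfilter : (range ((tightSet X c).card - 2)).filter
      (fun i => ({fVert X c 0, fVert X c 1} : Finset E3) ⊆ fanVerts X (c, i)) = {0} := by
    ext i
    rw [Finset.mem_filter, Finset.mem_range, Finset.mem_singleton]
    constructor
    · rintro ⟨hi, hsub⟩
      rw [pair_subset_fanVerts_iff hX1 hc (by omega) (by omega) (by omega)] at hsub
      omega
    · rintro rfl
      refine ⟨by omega, ?_⟩
      rw [pair_subset_fanVerts_iff hX1 hc (by omega) (by omega) (by omega)]
      omega
  rw [hfilter, Finset.card_singleton]

/-- **The last polygon side `{w 0, w (m_c − 1)}` lies in exactly one fan triangle of its facet**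
(`i = m_c − 3`). [folklore] -/
theorem countInFacet_last (hX1 : ∀ y ∈ X, ‖y‖ = 1) {c : E3} (hc : c ∈ facetNormals X) :
    countInFacet X c {fVert X c 0, fVert X c ((tightSet X c).card - 1)} = 1 := by
  have hm : 3 ≤ (tightSet X c).card := three_le_card_tightSet hc
  unfold countInFacet
  have hfilter : (range ((tightSet X c).card - 2)).filter
      (fun i => ({fVert X c 0, fVert X c ((tightSet X c).card - 1)} : Finset E3) ⊆
        fanVerts X (c, i)) = {(tightSet X c).card - 3} := by
    ext i
    rw [Finset.mem_filter, Finset.mem_range, Finset.mem_singleton]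
    constructor
    · rintro ⟨hi, hsub⟩
      rw [pair_subset_fanVerts_iff hX1 hc (by omega) (by omega) (by omega)] at hsub
      omega
    · rintro rfl
      refine ⟨by omega, ?_⟩
      rw [pair_subset_fanVerts_iff hX1 hc (by omega) (by omega) (by omega)]
      omega
  rw [hfilter, Finset.card_singleton]

/-- **A polygon side `{w a, w (a+1)}` with `1 ≤ a` lies in exactly one fan triangle of its facet**
(`i = a − 1`). [folklore] -/
theorem countInFacet_side (hX1 : ∀ y ∈ X, ‖y‖ = 1) {c : E3} (hc : c ∈ facetNormals X) {a : ℕ}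
    (h1 : 1 ≤ a) (ha : a + 1 < (tightSet X c).card) :
    countInFacet X c {fVert X c a, fVert X c (a + 1)} = 1 := by
  unfold countInFacet
  have hfilter : (range ((tightSet X c).card - 2)).filter
      (fun i => ({fVert X c a, fVert X c (a + 1)} : Finset E3) ⊆ fanVerts X (c, i)) = {a - 1} := by
    ext i
    rw [Finset.mem_filter, Finset.mem_range, Finset.mem_singleton]
    constructor
    · rintro ⟨hi, hsub⟩
      rw [pair_subset_fanVerts_iff hX1 hc (by omega) ha (by omega)] at hsub
      omega
    · rintro rfl
      refine ⟨by omega, ?_⟩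
      rw [pair_subset_fanVerts_iff hX1 hc (by omega) ha (by omega)]
      omega
  rw [hfilter, Finset.card_singleton]

/-- **A hull edge inside a facet lies in exactly one fan triangle of that facet** (it joins
consecutive vertices, `consecutive_of_mem_hullEdges`). [folklore] -/
theorem countInFacet_eq_one_of_mem_hullEdges (hX1 : ∀ y ∈ X, ‖y‖ = 1)
    (h0 : (0 : E3) ∈ interior (convexHull ℝ (X : Set E3))) {c : E3} (hc : c ∈ facetNormals X)
    {s : Finset E3} (hs : s ∈ hullEdges X) (hsc : s ⊆ tightSet X c) : countInFacet X c s = 1 := by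
  set hc0 := ne_zero_of_mem_facetNormals hX1 hc
  have hmf : (facetAngles X c hc0).card = (tightSet X c).card := card_facetAngles hX1 hc0
  have hm : 3 ≤ (tightSet X c).card := three_le_card_tightSet hc
  obtain ⟨j, hj, hsj⟩ := consecutive_of_mem_hullEdges hX1 h0 hc hs hsc
  rw [hmf] at hj hsj
  rw [← fVert_eq hc0, ← fVert_eq hc0] at hsj
  rw [hsj]
  rcases Nat.lt_or_ge (j + 1) (tightSet X c).card with hlt | hge
  · rw [Nat.mod_eq_of_lt hlt]
    rcases Nat.eq_zero_or_pos j with rfl | hjpos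
    · exact countInFacet_first hX1 hc
    · exact countInFacet_side hX1 hc hjpos hlt
  · obtain rfl : j = (tightSet X c).card - 1 := by omega
    rw [show (tightSet X c).card - 1 + 1 = (tightSet X c).card by omega, Nat.mod_self,
      Finset.pair_comm]
    exact countInFacet_last hX1 hc

end InFacet

/-! ### Part D. Every side of a fan triangle lies in exactly two fan triangles -/

section TwoTriangles

/-- Counting over all fan triangles is counting facet by facet. [folklore] -/
theorem card_filter_fanTriangles_eq_sum (X : Finset E3) (s : Finset E3) :
    ((fanTriangles X).filter fun q => s ⊆ fanVerts X q).card =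
      ∑ c ∈ facetNormals X, countInFacet X c s := by
  classical
  unfold fanTriangles countInFacet
  rw [Finset.filter_filter, Finset.card_filter, Finset.sum_product]
  refine Finset.sum_congr rfl fun c hc => ?_
  rw [Finset.card_filter]
  have hle : (tightSet X c).card ≤ X.card := Finset.card_le_card (tightSet_subset X c)
  -- both sides count the `i < #X` with `i + 2 < m_c ∧ s ⊆ fanVerts (c, i)`
  rw [← Finset.sum_range_add_sum_Ico _ (show (tightSet X c).card - 2 ≤ X.card by omega)]
  have hzero : ∑ i ∈ Finset.Ico ((tightSet X c).card - 2) X.card,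
      (if (c, i).2 + 2 < (tightSet X (c, i).1).card ∧ s ⊆ fanVerts X (c, i) then 1 else 0) = 0 := by
    refine Finset.sum_eq_zero fun i hi => ?_
    rw [Finset.mem_Ico] at hi
    rw [if_neg]
    simp only [not_and]
    intro h; omega
  rw [hzero, add_zero]
  refine Finset.sum_congr rfl fun i hi => ?_
  have hi' := Finset.mem_range.1 hi
  by_cases h : s ⊆ fanVerts X (c, i)
  · rw [if_pos ⟨by simp only; omega, h⟩, if_pos h]
  · rw [if_neg (fun h' => h h'.2), if_neg h]

/-- The sum of the facet counts of a hull edge is `2`. [folklore] -/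
theorem sum_countInFacet_of_mem_hullEdges (hX1 : ∀ y ∈ X, ‖y‖ = 1)
    (h0 : (0 : E3) ∈ interior (convexHull ℝ (X : Set E3))) {s : Finset E3} (hs : s ∈ hullEdges X) :
    ∑ c ∈ facetNormals X, countInFacet X c s = 2 := by
  classical
  have hsplit : ∀ c ∈ facetNormals X,
      countInFacet X c s = if s ⊆ tightSet X c then 1 else 0 := by
    intro c hc
    by_cases h : s ⊆ tightSet X c
    · rw [if_pos h, countInFacet_eq_one_of_mem_hullEdges hX1 h0 hc hs h]
    · rw [if_neg h, countInFacet_eq_zero_of_not_subset hX1 hc h]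
  rw [Finset.sum_congr rfl hsplit, Finset.sum_boole, Nat.cast_id]
  exact card_facetsOfEdge hX1 h0 hs

/-- A two-element subset of the three vertices of a fan triangle is one of its three sides.
[folklore] -/
theorem pair_cases_of_subset_fanVerts {p : E3 × ℕ} {s : Finset E3} (hs : s ⊆ fanVerts X p)
    (h2 : s.card = 2) :
    s = {fVert X p.1 0, fVert X p.1 (p.2 + 1)} ∨ s = {fVert X p.1 0, fVert X p.1 (p.2 + 2)} ∨
      s = {fVert X p.1 (p.2 + 1), fVert X p.1 (p.2 + 2)} := by
  obtain ⟨x, y, hxy, rfl⟩ := Finset.card_eq_two.1 h2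
  have hx : x ∈ fanVerts X p := hs (Finset.mem_insert_self _ _)
  have hy : y ∈ fanVerts X p := hs (Finset.mem_insert_of_mem (Finset.mem_singleton_self _))
  unfold fanVerts at hx hy
  rw [Finset.mem_insert, Finset.mem_insert, Finset.mem_singleton] at hx hy
  rcases hx with rfl | rfl | rfl <;> rcases hy with rfl | rfl | rfl
  · exact absurd rfl hxy
  · exact Or.inl rfl
  · exact Or.inr (Or.inl rfl)
  · exact Or.inl (Finset.pair_comm _ _)
  · exact absurd rfl hxy
  · exact Or.inr (Or.inr rfl)
  · exact Or.inr (Or.inl (Finset.pair_comm _ _))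
  · exact Or.inr (Or.inr (Finset.pair_comm _ _))
  · exact absurd rfl hxy

/-- **A diagonal of a facet lies in no other facet** (else the two facets would share a hull
edge joining non-consecutive vertices). [folklore] -/
theorem not_subset_tightSet_of_diagonal (hX1 : ∀ y ∈ X, ‖y‖ = 1)
    (h0 : (0 : E3) ∈ interior (convexHull ℝ (X : Set E3))) {c c' : E3} (hc : c ∈ facetNormals X)
    (hc' : c' ∈ facetNormals X) (hcc : c ≠ c') {b : ℕ} (h2 : 2 ≤ b) (hb : b + 2 ≤ (tightSet X c).card) :
    ¬({fVert X c 0, fVert X c b} : Finset E3) ⊆ tightSet X c' := by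
  intro hsub
  set hc0 := ne_zero_of_mem_facetNormals hX1 hc
  have hmf : (facetAngles X c hc0).card = (tightSet X c).card := card_facetAngles hX1 hc0
  have hne : fVert X c 0 ≠ fVert X c b := fun h => by
    have := fVert_injective_of_lt hX1 hc (by omega) (by omega) h; omega
  have hu : fVert X c 0 ∈ tightSet X c := fVert_mem_tightSet_of_lt hX1 hc (by omega)
  have hv : fVert X c b ∈ tightSet X c := fVert_mem_tightSet_of_lt hX1 hc (by omega)
  have hu' : fVert X c 0 ∈ tightSet X c' := hsub (Finset.mem_insert_self _ _)
  have hv' : fVert X c b ∈ tightSet X c' :=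
    hsub (Finset.mem_insert_of_mem (Finset.mem_singleton_self _))
  have hedge := pair_mem_hullEdges_of_two_facets hX1 hc hc' hcc hu hv hu' hv' hne
  obtain ⟨j, hj, hsj⟩ := consecutive_of_mem_hullEdges hX1 h0 hc hedge
    (Finset.insert_subset_iff.2 ⟨hu, Finset.singleton_subset_iff.2 hv⟩)
  rw [hmf] at hj hsj
  rw [← fVert_eq hc0, ← fVert_eq hc0] at hsj
  have hinj : Set.InjOn (fVert X c) (range (tightSet X c).card : Set ℕ) := by
    intro x hx y hy hxy
    exact fVert_injective_of_lt hX1 hc (Finset.mem_range.1 (Finset.mem_coe.1 hx))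
      (Finset.mem_range.1 (Finset.mem_coe.1 hy)) hxy
  rcases pair_indices_of_pair_eq hinj (by omega) (by omega) hj (Nat.mod_lt _ (by omega))
    (by omega) hsj with ⟨h0j, hbj⟩ | ⟨h0j, hbj⟩
  · -- `0 = j`, `b = (j+1) % m = 1`
    rw [← h0j, Nat.zero_add, Nat.mod_eq_of_lt (by omega)] at hbj
    omega
  · -- `0 = (j+1) % m` forces `j = m − 1 = b`
    rcases Nat.lt_or_ge (j + 1) (tightSet X c).card with hlt | hge
    · rw [Nat.mod_eq_of_lt hlt] at h0j; omega
    · omega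

/-- **Every side of a fan triangle lies in exactly two fan triangles** (the fan triangles of
the hull of a spherical code form a closed combinatorial surface). [folklore] -/
theorem card_fanTriangles_filter_eq_two (hX1 : ∀ y ∈ X, ‖y‖ = 1)
    (h0 : (0 : E3) ∈ interior (convexHull ℝ (X : Set E3))) {p : E3 × ℕ} (hp : p ∈ fanTriangles X)
    {s : Finset E3} (hs : s ⊆ fanVerts X p) (h2 : s.card = 2) :
    ((fanTriangles X).filter fun q => s ⊆ fanVerts X q).card = 2 := by
  classical
  obtain ⟨c, i⟩ := p
  obtain ⟨hc, hi⟩ := mem_fanTriangles.1 hp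
  simp only at hc hi hs
  set hc0 := ne_zero_of_mem_facetNormals hX1 hc
  have hmf : (facetAngles X c hc0).card = (tightSet X c).card := card_facetAngles hX1 hc0
  rw [card_filter_fanTriangles_eq_sum]
  -- polygon sides are hull edges: total `2` by the two facets through the edge
  have hside : ∀ {j : ℕ}, j < (tightSet X c).card →
      ∑ c' ∈ facetNormals X, countInFacet X c'
        {fVert X c j, fVert X c ((j + 1) % (tightSet X c).card)} = 2 := by
    intro j hj
    apply sum_countInFacet_of_mem_hullEdges hX1 h0
    have h := pair_mem_hullEdges_of_consecutive hX1 hc (j := j) (by rw [hmf]; exact hj)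
    rwa [hmf, ← fVert_eq hc0, ← fVert_eq hc0] at h
  -- diagonals: `2` in their own facet, `0` elsewhere
  have hdiag : ∀ {b : ℕ}, 2 ≤ b → b + 2 ≤ (tightSet X c).card →
      ∑ c' ∈ facetNormals X, countInFacet X c' {fVert X c 0, fVert X c b} = 2 := by
    intro b h2b hb
    rw [← Finset.add_sum_erase _ _ hc, countInFacet_diagonal hX1 hc h2b hb]
    have hz : ∑ c' ∈ (facetNormals X).erase c,
        countInFacet X c' {fVert X c 0, fVert X c b} = 0 := by
      refine Finset.sum_eq_zero fun c' hc' => ?_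
      obtain ⟨hne, hc'F⟩ := Finset.mem_erase.1 hc'
      exact countInFacet_eq_zero_of_not_subset hX1 hc'F
        (not_subset_tightSet_of_diagonal hX1 h0 hc hc'F (Ne.symm hne) h2b hb)
    rw [hz]
  rcases pair_cases_of_subset_fanVerts hs h2 with rfl | rfl | rfl
  · -- `{w 0, w (i+1)}`: first side (`i = 0`) or a diagonal
    rcases Nat.eq_zero_or_pos i with rfl | hipos
    · have h := hside (j := 0) (by omega)
      rwa [Nat.zero_add, Nat.mod_eq_of_lt (by omega : 1 < (tightSet X c).card)] at h
    · exact hdiag (by omega) (by omega)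
  · -- `{w 0, w (i+2)}`: last side (`i + 3 = m`) or a diagonal
    rcases Nat.lt_or_ge (i + 3) (tightSet X c).card with hlt | hge
    · exact hdiag (by omega) (by omega)
    · have h := hside (j := i + 2) hi
      rw [show i + 2 + 1 = (tightSet X c).card by omega, Nat.mod_self, Finset.pair_comm] at h
      exact h
  · -- `{w (i+1), w (i+2)}`: a polygon side
    have h := hside (j := i + 1) (by omega)
    rwa [Nat.mod_eq_of_lt (by omega : i + 1 + 1 < (tightSet X c).card)] at h

end TwoTriangles

end Literature.Geometry.DiscreteGeometry

end
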